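import Literature.Topology.CoveringSpaces.CoveringSectionExtension
import HarnessLib

/-!
# Extension of continuous sections of a covering map — DEPRECATED ALIASES (module moved)

Topic `Literature/Topology`. This depth-2 module (no sub-topic directory) was **moved** on
2026-08-16 to the path-aligned home
`Literature/Topology/CoveringSpaces/CoveringSectionExtension.lean`
(namespace `Literature.Topology.CoveringSpaces`; librarian refactor items wi-32936 / wi-32940),
where the four results — J. Cerf, *Sur les difféomorphismes de la sphère de dimension trois
(Γ₄ = 0)*, LNM 53 (1968), Ch. I §4, Lemmes 5 and 6 on extending continuous sections of a
covering — live with byte-identical statements and proofs.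

This module only keeps the OLD names `Literature.Topology.<decl>` alive, deprecated, so that
nothing is deleted outright (librarian refactor protocol: old names kept as deprecated aliases).
Three of them are `alias`es of the moved declarations; the headline Lemme 6,
`exists_section_extension_of_dense_paths`, is kept as a deprecated `theorem` with its statement
verbatim and the moved theorem as its one-line proof (a module must declare at least one
`theorem` for the gate's declaration lint; an alias-probe / near-duplicate hit on it is therefore
expected and moot). No module of the tree imported the old path at the time of the move. Do not
add results here; extend `Literature/Topology/CoveringSpaces/CoveringSectionExtension.lean`.

* `exists_local_section_extension` — alias of
  `Literature.Topology.CoveringSpaces.exists_local_section_extension` (core of Lemme 5);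
* `exists_section_extension_closure` — alias of
  `Literature.Topology.CoveringSpaces.exists_section_extension_closure` (Lemme 5);
* `locallyJoined_of_dense_paths` — alias of
  `Literature.Topology.CoveringSpaces.locallyJoined_of_dense_paths` (reduction in Lemme 6);
* `exists_section_extension_of_dense_paths` — deprecated restatement, proved by
  `Literature.Topology.CoveringSpaces.exists_section_extension_of_dense_paths` (Lemme 6).

## References

* J. Cerf, *Sur les difféomorphismes de la sphère de dimension trois (Γ₄ = 0)*, Lecture Notes in
  Mathematics 53, Springer (1968), Ch. I §4, Lemmes 5, 6. [CerfDiffeoSphere1968]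
-/

open Set Topology

namespace Literature.Topology

universe u v

/-- Deprecated alias (module moved 2026-08-16) — use
`Literature.Topology.CoveringSpaces.exists_local_section_extension`: **local extension through one
sheet**, the core of Cerf's Lemme 5 (near every point of `ℬ̄` a continuous local section of the
covering agreeing with `σ` on `V ∩ ℬ`). [cite: CerfDiffeoSphere1968, Ch. I §4, Lemme 5] -/
@[deprecated Literature.Topology.CoveringSpaces.exists_local_section_extension
  (since := "2026-08-16")]
alias exists_local_section_extension :=
  Literature.Topology.CoveringSpaces.exists_local_section_extension

/-- Deprecated alias (module moved 2026-08-16) — use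
`Literature.Topology.CoveringSpaces.exists_section_extension_closure`: **Cerf's Lemme 5**, a
continuous section of a covering over `ℬ` extends continuously over the closure `ℬ̄` when the
base is locally connected and `ℬ` is locally arc-connected in the base at the points of `ℬ̄`
(total space Hausdorff). [cite: CerfDiffeoSphere1968, Ch. I §4, Lemme 5] -/
@[deprecated Literature.Topology.CoveringSpaces.exists_section_extension_closure
  (since := "2026-08-16")]
alias exists_section_extension_closure :=
  Literature.Topology.CoveringSpaces.exists_section_extension_closure

/-- Deprecated alias (module moved 2026-08-16) — use
`Literature.Topology.CoveringSpaces.locallyJoined_of_dense_paths`: the reduction in Cerf's proof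
of Lemme 6 — over a locally path connected base, density of the paths of an open `ℬ` in the paths
of the base (compact-open topology) makes `ℬ` locally arc-connected in the base at every point.
[cite: CerfDiffeoSphere1968, Ch. I §4, Lemme 6] -/
@[deprecated Literature.Topology.CoveringSpaces.locallyJoined_of_dense_paths
  (since := "2026-08-16")]
alias locallyJoined_of_dense_paths :=
  Literature.Topology.CoveringSpaces.locallyJoined_of_dense_paths

variable {A : Type u} {R : Type v} [TopologicalSpace A] [TopologicalSpace R]

/-- Deprecated (module moved 2026-08-16) — use
`Literature.Topology.CoveringSpaces.exists_section_extension_of_dense_paths`, of which this is the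
verbatim restatement under the old name (one-line proof by the moved theorem): **Cerf's Lemme 6**,
over a locally path connected base a continuous section of a covering over an open dense `ℬ`
extends to a global continuous section as soon as the paths of `ℬ` are dense in the paths of the
base (compact-open topology; total space Hausdorff).
[cite: CerfDiffeoSphere1968, Ch. I §4, Lemme 6] -/
@[deprecated Literature.Topology.CoveringSpaces.exists_section_extension_of_dense_paths
  (since := "2026-08-16")]
theorem exists_section_extension_of_dense_paths [T2Space R] {p : R → A} (hp : IsCoveringMap p)
    [LocallyPathConnectedSpace A] {B : Set A} (hBo : IsOpen B) (hBd : Dense B)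
    (hdense : ∀ (γ : C(unitInterval, A)) (N : Set C(unitInterval, A)), N ∈ 𝓝 γ →
      ∃ γ' ∈ N, ∀ t, γ' t ∈ B)
    {σ : A → R} (hσ : ContinuousOn σ B) (hpσ : ∀ b ∈ B, p (σ b) = b) :
    ∃ τ : A → R, Continuous τ ∧ (∀ y, p (τ y) = y) ∧ ∀ b ∈ B, τ b = σ b :=
  Literature.Topology.CoveringSpaces.exists_section_extension_of_dense_paths hp hBo hBd hdense hσ hpσ

end Literature.Topology
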